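import Literature.AnabelianGeometry.SemiGraphs.MetabelianLeafStarScalingEndomorphism
import Literature.AnabelianGeometry.SemiGraphs.TemperedReconstructionCor39aSourceNecessity
import HarnessLib

/-!
# [SemiAnbd] Cor. 3.9 (a) FAILS at the pair `(𝒢⋆(p), 𝒢⋆(p))`: the level-collapsing scaling endomorphism of the
# rayless star folds the exotic maximal compact `⟨c⟩‾` into a vertex group («COR39-UPTOTWIST@RAYLESS-STAR»,
# the (a)-SOURCE quadrant, file 2)

Mochizuki, *Semi-graphs of anabelioids*, Publ. RIMS **42** (2006), §3, Corollary 3.9 and its proof, manuscript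
pp. 42–43 (p. 42: a locally open morphism "determines a morphism of temperoids `B^temp(G) → B^temp(H)` [cf.
Proposition 3.6, (iv)] whose quasi-geometricity follows by 'substituting' the equivalences of Theorem 3.7, (iv),
into Definition 3.8"), Def. 3.8 p. 42, Prop. 3.6 (iv) p. 39 [cite: MochizukiSemiAnbd2006, Cor 3.9 pp.42-43].

PROOF-ONLY file (no definition, no named fact; abc-iut cell, layer L3, row «COR39-UPTOTWIST@RAYLESS-STAR
(a)-source quadrant» (L3-lead gen 8 δ22 (1)), seat abc-iut-L3-t8 gen 8 — the last open quadrant of the cell's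
Cor-3.9 table at the rayless star (abc-iut-L3-t10 gen 12–14: (a)-target ✓, (b)-source ✓, (b)-target ✓/✗)).
THE WITNESS.  Source = target = `𝒢⋆(p) = metabelianLeafStar p` (every prime `p`, canonical chart);
`F_k : 𝒢⋆(p) → 𝒢⋆(p)` the SCALING ENDOMORPHISM: the identity on the underlying star, on the centre `F̂₂⁽ᵖ⁾` and on
every edge group `ℤ_p`, and on the leaf `n` the open endomorphism `(z, u) ↦ (p^{k_n}·z, u)` of
`Leaf n = ℤ_p ⋊ ⟨1+p^{n+1}⟩‾` (`Iw.exists_leafScaling`), `k_n ≥ N_j` for all `j ≤ n` (the level bounds of the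
canonical tower); all 2-cells hold with conjugator `1`, and `F_k` is LOCALLY OPEN.  Let `φ` be induced by `F_k`
(Prop. 3.6 (iv), abc-iut-L3-t10's `inducedHomOfMorphism_induces`; compatible with `F_k` on verticial and edge
homomorphisms).  Then by (CompatV) at the leaf `n` the image `φ(m_n)` of the unit translation is a conjugate of
`ψ_n(transl^{p^{k_n}})`, which dies at every level `j ≤ n` (uniform vanishing of `p^{N_j}`-th powers,
`gal_leafSeq_translLeaf_pow`): `φ` is TAIL-TRIVIAL, so (file 1, `escape_image_eq_conj_of_tail_trivial`)
`φ(c) = h·φ(ψ₀(a))·h⁻¹ = (h g₀)·ψ₀(a)·(h g₀)⁻¹` lies in a VERTICIAL subgroup and is `≠ 1`; by file 1's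
`not_isQuasiGeometric_of_apply_escape_mem_verticial`, `φ` is NOT quasi-geometric (Def. 3.8 fails at the abelian
exotic maximal compact `⟨c⟩‾`).  Hence:

* ★ `metabelianLeafStar_exists_induces_not_isQuasiGeometric` — ∃ locally open `F : 𝒢⋆(p) → 𝒢⋆(p)` (identity on
  the underlying graph) and `φ` INDUCED by `F` (`Hom.Induces`, `InducesUpToTwist`, `CompatV`, `CompatE`) with
  `¬ IsQuasiGeometric φ`;
* ★ `metabelianLeafStar_not_cor39a_self` — **clause (a) of Cor. 3.9 up to twist FAILS at the pair
  `(𝒢⋆(p), 𝒢⋆(p))`** (abc-iut-L3-t10's currency `InducesUpToTwist` / `IsCompatiblyQuasiGeometric`): the (a)-SOURCE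
  quadrant of the star table is ✗;
* ★ `not_forall_topCyclic_cor39a_endomorphism` — the ¬∀ form: it is FALSE that for every Cor-3.9 graph with
  topologically cyclic edge groups every homomorphism induced by a locally open ENDOMORPHISM is quasi-geometric;
* `metabelianLeafStar_forall_not_isQuasiGeometric_loopGraph` — remark: NO continuous
  `π₁^temp(𝒢⋆(p)) → π₁^temp(loopGraph p)` is quasi-geometric (abc-iut-w6-d099's lemma at the abelian maximal compact
  `⟨c⟩‾`), so at `(𝒢⋆(p), loopGraph p)` clause (a) can hold only vacuously.

HONEST FRAMING: OUR rendering at OUR typed objects (the ∀-countable typing; the witness is an infinite graph of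
anabelioids where «maximal compact = verticial» fails); outside the [IUTchIII] Cor. 3.12 cone — every print consumer
of Cor. 3.9 has a finite dual graph, where clause (a) is a theorem of the finite files; Cor. 3.9 as printed and as
used is not claimed false; nothing asserts abc proved or refuted; no side is taken on [IUTchIII] Cor. 3.12; typed ≠
proved.
-/

noncomputable section

open CategoryTheory Topology Multiplicative Filter

namespace Literature.AnabelianGeometry.SemiGraphs

open IwahoriWitness

namespace ProfiniteSemiGraph

variable (p : ℕ) [hp : Fact p.Prime]

/-! ### The witness: the scaling endomorphism and its induced homomorphism -/

/-- ★ **At `(𝒢⋆(p), 𝒢⋆(p))` there are a LOCALLY OPEN endomorphism `F` (the identity on the underlying star) and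
a homomorphism `φ` INDUCED by `F` (Prop. 3.6 (iv): `Hom.Induces`, hence up to twist, and compatible with `F` on
verticial and edge homomorphisms) which is NOT quasi-geometric** (canonical chart, every prime `p`).  See the
module docstring: `F` is the level-collapsing scaling endomorphism, `φ` is tail-trivial, so `φ(c)` is a
non-trivial element of a verticial subgroup. [cite: MochizukiSemiAnbd2006, Cor 3.9 p.42] -/
theorem metabelianLeafStar_exists_induces_not_isQuasiGeometric (h36 : (metabelianLeafStar p).Prop36Hypotheses) :
    ∃ (F : Hom (metabelianLeafStar p) (metabelianLeafStar p))
      (φ : ((metabelianLeafStar p).temperedPiChart h36).G →ₜ* ((metabelianLeafStar p).temperedPiChart h36).G),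
      F.IsLocallyOpen ∧ F.base = SemiGraph.Hom.id _ ∧ F.Induces _ _ φ ∧ F.InducesUpToTwist _ _ φ ∧ F.CompatV _ _ φ ∧
        F.CompatE _ _ φ ∧ ¬ IsQuasiGeometric φ := by
  classical
  let Dg := (metabelianLeafStar p).galoisLevelData h36
  have hc := h36.isCountable
  -- level bounds `k n ≥ N_j` for all `j ≤ n`
  let k : ℕ → ℕ := fun n => (Finset.range (n + 1)).sup (lvl h36)
  have hk : ∀ j n, j ≤ n → lvl h36 j ≤ k n := fun j n hjn =>
    Finset.le_sup (f := lvl h36) (Finset.mem_range.mpr (Nat.lt_succ_of_le hjn))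
  -- the scaling endomorphisms of the leaves
  choose sc hsc hsco using fun n => Iw.exists_leafScaling (p := p) n (k n)
  -- THE SCALING ENDOMORPHISM of `𝒢⋆(p)`
  let F : Hom (metabelianLeafStar p) (metabelianLeafStar p) :=
    { base := SemiGraph.Hom.id _
      hV := fun v => match v with
        | none => ContinuousMonoidHom.id _
        | some n => sc n
      hE := fun _ => ContinuousMonoidHom.id _
      comm := by
        rintro ⟨m, b⟩ v h
        have hv : SemiGraph.leafStarVertexOf (m, b) = v := Option.some.inj h
        subst hv
        refine ⟨1, fun x => ?_⟩
        rw [one_mul, inv_one, mul_one]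
        cases b
        · -- at the leaf `m`: the scaling fixes the torus image `lowHom m x` (translation coordinate `0`)
          change sc m (Iw.lowHom m x) = Iw.lowHom m x
          apply Subtype.ext
          rw [hsc, Iw.coe_lowHom]
          ext
          · simp [Iw.bHom_a]
          · rfl
        · -- at the centre: the identity
          rfl }
  have hFopen : F.IsLocallyOpen := by
    refine ⟨fun v => ?_, fun e => ?_⟩
    · cases v with
      | none =>
        change IsOpen (((ContinuousMonoidHom.id (FreeProPRankTwo.Grp p)).toMonoidHom.range :
          Subgroup (FreeProPRankTwo.Grp p)) : Set (FreeProPRankTwo.Grp p))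
        rw [show ((ContinuousMonoidHom.id (FreeProPRankTwo.Grp p)).toMonoidHom.range :
            Subgroup (FreeProPRankTwo.Grp p)) = ⊤ from MonoidHom.range_eq_top.mpr fun x => ⟨x, rfl⟩,
          Subgroup.coe_top]
        exact isOpen_univ
      | some n => exact hsco n
    · change IsOpen (((ContinuousMonoidHom.id (Multiplicative ℤ_[p])).toMonoidHom.range :
        Subgroup (Multiplicative ℤ_[p])) : Set (Multiplicative ℤ_[p]))
      rw [show ((ContinuousMonoidHom.id (Multiplicative ℤ_[p])).toMonoidHom.range :
          Subgroup (Multiplicative ℤ_[p])) = ⊤ from MonoidHom.range_eq_top.mpr fun x => ⟨x, rfl⟩,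
        Subgroup.coe_top]
      exact isOpen_univ
  -- the induced homomorphism (Prop. 3.6 (iv))
  obtain ⟨φ, hind, hV, hE, -⟩ := inducedHomOfMorphism_induces h36 h36 F
    ((metabelianLeafStar p).temperedPiChart h36) ((metabelianLeafStar p).temperedPiChart h36)
  refine ⟨F, φ, hFopen, rfl, hind, F.inducesUpToTwist_of_induces _ _ φ hind, hV, hE, ?_⟩
  -- the escaping element
  obtain ⟨P₀⟩ := GaloisLevelData.nonempty_pointSeq h36 (leafStarCentre p)
  obtain ⟨c, N, hcN, hC, hact⟩ := exists_escapeLimit P₀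
  -- `φ` read on the tower's group
  let φ₁ : Dg.temperedPi hc →* Dg.temperedPi hc := φ.toMonoidHom
  have hφ₁_apply : ∀ x, φ₁ x = φ x := fun _ => rfl
  -- the scaling reads `transl ↦ transl^{p^{k n}}` on the unit translation of the leaf `n`
  have hx : ∀ n : ℕ, F.hV (leafStarLeaf p n) (Iw.translLeaf n) = Iw.translLeaf n ^ p ^ k n := by
    intro n
    change sc n (Iw.translLeaf n) = Iw.translLeaf n ^ p ^ k n
    apply Subtype.ext
    rw [hsc, Subgroup.coe_pow]
    change (⟨(p : ℤ_[p]) ^ k n * (Iw.transl (p := p)).a, (Iw.transl (p := p)).s⟩ : Iw p) = Iw.transl ^ p ^ k n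
    rw [Iw.transl_pow]
    ext
    · simp
    · simp
  -- TAIL TRIVIALITY: `ρ_j(φ(m_n)) = 1` for `j ≤ n` ((CompatV) at the leaf `n` + uniform vanishing of `p^{N_j}`)
  have htail : ∀ j n, j ≤ n → Dg.proj hc j (φ (escM P₀ n)) = 1 := by
    intro j n hjn
    obtain ⟨g, hg⟩ := hV (leafStarLeaf p n) (leafSeq P₀ n).decompHomCont (leafSeq P₀ n).decompHomCont
      (leafSeq P₀ n).isVerticialHom_decompHomCont (leafSeq P₀ n).isVerticialHom_decompHomCont
    obtain ⟨g₁, rfl⟩ : ∃ g₁ : Dg.temperedPi hc, g₁ = g := ⟨g, rfl⟩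
    have e : φ₁ (escM P₀ n) = g₁ * (leafSeq P₀ n).decompHom (Iw.translLeaf n ^ p ^ k n) * g₁⁻¹ := by
      have h1 := hg (Iw.translLeaf n)
      rw [hx n] at h1
      exact h1
    change Dg.proj hc j (φ₁ (escM P₀ n)) = 1
    rw [e, map_mul, map_mul, map_inv, (leafSeq P₀ n).proj_decompHom, gal_leafSeq_translLeaf_pow P₀ n j (k n)
      (hk j n hjn), mul_one, mul_inv_cancel]
  -- hence `φ(c) = h φ(ψ₀ a) h⁻¹` (file 1) and, by (CompatV) at the centre, `φ(ψ₀ a) = g₀ ψ₀(a) g₀⁻¹`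
  obtain ⟨h, hh⟩ := escape_image_eq_conj_of_tail_trivial P₀ c N hcN φ htail
  obtain ⟨g₀, hg₀⟩ := hV (leafStarCentre p) P₀.decompHomCont P₀.decompHomCont P₀.isVerticialHom_decompHomCont
    P₀.isVerticialHom_decompHomCont
  obtain ⟨h₁, rfl⟩ : ∃ h₁ : Dg.temperedPi hc, h₁ = h := ⟨h, rfl⟩
  obtain ⟨g₁, rfl⟩ : ∃ g₁ : Dg.temperedPi hc, g₁ = g₀ := ⟨g₀, rfl⟩
  have hhT : φ₁ c = h₁ * φ₁ (escY P₀) * h₁⁻¹ := hh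
  have hyT : φ₁ (escY P₀) = g₁ * P₀.decompHom (FreeProPRankTwo.a p) * g₁⁻¹ := hg₀ (FreeProPRankTwo.a p)
  have key : φ₁ c = (P₀.smul (h₁ * g₁)).decompHom (FreeProPRankTwo.a p) := by
    rw [GaloisLevelData.PointSeq.decompHom_smul, hhT, hyT, mul_inv_rev]
    simp only [mul_assoc]
  -- `φ(c)` lies in the verticial subgroup `ψ_{(h g₀)·P₀}(Π_centre)` and is `≠ 1`
  have hVmem := (P₀.smul (h₁ * g₁)).range_decompHom_mem_verticialSubgroups
  have hcV : φ c ∈ ((P₀.smul (h₁ * g₁)).decompHom).range := ⟨FreeProPRankTwo.a p, key.symm⟩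
  have hc1 : φ c ≠ 1 := by
    intro h0
    have hinj : Function.Injective (P₀.smul (h₁ * g₁)).decompHomCont :=
      (verticialInjective_holds _ (metabelianLeafStar_thm37Hypotheses' p) ((metabelianLeafStar p).temperedPiChart h36)
        (leafStarCentre p)).2 _ (P₀.smul (h₁ * g₁)).isVerticialHom_decompHomCont
    have h2 : (P₀.smul (h₁ * g₁)).decompHomCont (FreeProPRankTwo.a p) = (P₀.smul (h₁ * g₁)).decompHomCont 1 := by
      rw [map_one]
      change (P₀.smul (h₁ * g₁)).decompHom (FreeProPRankTwo.a p) = 1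
      rw [← key]
      exact h0
    exact FreeProPRankTwo.a_ne_one p (hinj h2)
  exact not_isQuasiGeometric_of_apply_escape_mem_verticial P₀ c N hcN hC hact φ hVmem hcV hc1

/-! ### Clause (a) of Cor. 3.9, up to twist, fails at the pair `(𝒢⋆(p), 𝒢⋆(p))` -/

/-- ★ **Cor. 3.9 (a), up to twist, FAILS at the pair `(𝒢⋆(p), 𝒢⋆(p))`** (canonical charts, every prime `p`;
abc-iut-L3-t10's currencies `Hom.InducesUpToTwist` / `IsCompatiblyQuasiGeometric`): NOT every homomorphism induced
up to twist by a locally open endomorphism of the rayless star is compatibly quasi-geometric — the (a)-SOURCE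
quadrant of the star table is ✗. [cite: MochizukiSemiAnbd2006, Cor 3.9 p.42] -/
theorem metabelianLeafStar_not_cor39a_self (h36 : (metabelianLeafStar p).Prop36Hypotheses) :
    ¬ ∀ (F : Hom (metabelianLeafStar p) (metabelianLeafStar p)), F.IsLocallyOpen →
        ∀ φ : ((metabelianLeafStar p).temperedPiChart h36).G →ₜ* ((metabelianLeafStar p).temperedPiChart h36).G,
          F.InducesUpToTwist _ _ φ → IsCompatiblyQuasiGeometric φ := by
  intro ha
  obtain ⟨F, φ, hF, -, -, hind, -, -, hnq⟩ := metabelianLeafStar_exists_induces_not_isQuasiGeometric p h36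
  exact hnq (ha F hF φ hind).isQuasiGeometric

/-- The literal-`Induces` reading: NOT every homomorphism INDUCED (frozen chosen-family sense, Prop. 3.6 (iv)) by a
locally open endomorphism of `𝒢⋆(p)` is quasi-geometric in the literal sense of Def. 3.8.
[cite: MochizukiSemiAnbd2006, Cor 3.9 p.42] -/
theorem metabelianLeafStar_not_forall_induces_isQuasiGeometric (h36 : (metabelianLeafStar p).Prop36Hypotheses) :
    ¬ ∀ (F : Hom (metabelianLeafStar p) (metabelianLeafStar p)), F.IsLocallyOpen →
        ∀ φ : ((metabelianLeafStar p).temperedPiChart h36).G →ₜ* ((metabelianLeafStar p).temperedPiChart h36).G,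
          F.Induces _ _ φ → IsQuasiGeometric φ := by
  intro ha
  obtain ⟨F, φ, hF, -, hind, -, -, -, hnq⟩ := metabelianLeafStar_exists_induces_not_isQuasiGeometric p h36
  exact hnq (ha F hF φ hind)

/-- ★ **The ¬∀ form: clause (a) fails even for ENDOMORPHISMS of ONE Cor-3.9 graph of anabelioids all of whose
edge groups are topologically cyclic** (witness `𝒢⋆(3)`, its scaling endomorphism, the induced `φ`) — so in
abc-iut-L3-t10's `cor39a_upToTwistAt_of_topCyclic_target` the input «Thm. 3.7 (iii) at the source» is load-bearing
also on the class «TOP-CYCLIC», and cannot be replaced by any hypothesis shared by source and target.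
[cite: MochizukiSemiAnbd2006, Cor 3.9 pp.42-43] -/
theorem not_forall_topCyclic_cor39a_endomorphism :
    ¬ ∀ (𝒢 : ProfiniteSemiGraph.{0}), Cor39Hypotheses 𝒢 →
        (∀ e : 𝒢.graph.Edge, ∃ t₀ : 𝒢.Ge e, (Subgroup.zpowers t₀).topologicalClosure = ⊤) →
        ∀ (c𝒢 : TemperedPiChart 𝒢) (F : Hom 𝒢 𝒢), F.IsLocallyOpen →
          ∀ φ : c𝒢.G →ₜ* c𝒢.G, F.Induces c𝒢 c𝒢 φ → IsQuasiGeometric φ := by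
  intro h
  haveI : Fact (Nat.Prime 3) := ⟨Nat.prime_three⟩
  have h𝒢 : Cor39Hypotheses (metabelianLeafStar 3) := metabelianLeafStar_cor39Hypotheses 3
  exact metabelianLeafStar_not_forall_induces_isQuasiGeometric 3 h𝒢.toProp36Hypotheses
    (h _ h𝒢 (fun _ => ⟨ofAdd (1 : ℤ_[3]), FreeProPRankTwo.topologicalClosure_zpowers_ofAdd_one 3⟩) _)

/-! ### Remark: the Iwahori loop as a target -/

/-- **No continuous `π₁^temp(𝒢⋆(p)) → π₁^temp(loopGraph p)` is quasi-geometric** (canonical source chart, every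
target chart): the source has the ABELIAN maximal compact subgroup `⟨c⟩‾` (gen 7's B2), and the maximal compact
subgroups of `π₁^temp(loopGraph p)` are copies of `P = ℤ_p ⋊ (1+pℤ_p)`, which has no abelian open subgroup
(abc-iut-w6-d099's `not_isQuasiGeometric_loopGraph_of_abelian_maximalCompact`).  So at `(𝒢⋆(p), loopGraph p)`
clause (a) of Cor. 3.9 can hold only vacuously. [cite: MochizukiSemiAnbd2006, Def 3.8 p.42] -/
theorem metabelianLeafStar_forall_not_isQuasiGeometric_loopGraph (h36 : (metabelianLeafStar p).Prop36Hypotheses)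
    (cℋ : TemperedPiChart (IwahoriWitness.loopGraph p))
    (φ : ((metabelianLeafStar p).temperedPiChart h36).G →ₜ* cℋ.G) : ¬ IsQuasiGeometric φ := by
  obtain ⟨c, hmax, -, -, hcomm⟩ := metabelianLeafStar_exists_procyclic_exotic_maximalCompact p h36
  let C₀ : Subgroup ((metabelianLeafStar p).temperedPiChart h36).G := (Subgroup.zpowers c).topologicalClosure
  letI : CommGroup C₀ := { (inferInstance : Group C₀) with mul_comm := fun x y => Subtype.ext (hcomm x x.2 y y.2) }
  let ζ : C₀ →* ((metabelianLeafStar p).temperedPiChart h36).G :=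
    { toFun := fun x => (x : ((metabelianLeafStar p).temperedPiChart h36).G), map_one' := rfl, map_mul' := fun _ _ => rfl }
  have hζ : ζ.range = C₀ := by
    ext x
    constructor
    · rintro ⟨y, rfl⟩; exact y.2
    · intro hx; exact ⟨⟨x, hx⟩, rfl⟩
  refine not_isQuasiGeometric_loopGraph_of_abelian_maximalCompact p ζ ?_ cℋ φ
  rw [hζ]
  exact hmax

end ProfiniteSemiGraph

end Literature.AnabelianGeometry.SemiGraphs

end
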